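/-
Copyright: harness cell b2b-lgcu-borel (gen 20).  Honest framing: the VALUE here is a THEOREM
(a structural law on every hypothetical witness of the crux) — NOT summit progress; the crux item
`SubgroupIdentityDesigns` (stmt-MatrixMultiplication-14079) stays open and untouched.
-/
import Mathlib
import Summits.MatrixMultiplication.MatrixMultiplication.Theorems.LevelTwoBeatsCubes.Negative.GradedNeumannCount
import Summits.MatrixMultiplication.MatrixMultiplication.Theorems.SubgroupIdentityDesigns.Negative.PackingBridge

/-!
# The free-module law: graded Neumann counts inside the `K`-invariants of the test space

Route `LevelGradedCohnUmans`, crux `SubgroupIdentityDesigns` (stmt-MatrixMultiplication-14079), negative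
side; report `run/shared/lean/b2b/levelgraded-cu/ORACLE-g20.md` §G20-1.  VALUE = THEOREM (a new
all-`(p, m, k)` law on hypothetical witnesses, the first input beyond the two graded Neumann counts of
`WitnessNeumannCounts`), NOT summit progress; the crux item is untouched and remains open.

## The law (abstract form, any finite group)

Let `J ≤ ℂ^G` be BI-INVARIANT, `(H₁, H₂, H₃)` subgroup-TPP and `f ∈ J` an identity test (`f 1 = 1`,
`f (a b c) = 0` for `a b c ≠ 1`).  The graded Neumann count `packing_Z` says
`(|H₁| + |H₂| − 1) · |H₃| ≤ dim J`.  THIS FILE: for every subgroup `K ≤ H₃`,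

  `(|H₁| + |H₂| − 1) · [H₃ : K] ≤ dim J^K`,   `J^K = {f ∈ J | f (g k) = f g ∀ k ∈ K}`

(`index_mul_le_finrank_invRight`; `K = 1` is `packing_Z`).  Proof: PERIODISE the Neumann probes over
`K` — `h ↦ Σ_{k ∈ K} f (u⁻¹ h k⁻¹ r⁻¹)` (`u ∈ H₁ ∪ (H₂ ∖ 1)`, `r` running over representatives of the
left cosets `r K ⊆ H₃`) is right-`K`-invariant, lies in `J`, and its values at the points `u' r'` are
read off by the TPP (`idTest`): identity blocks on `H₁ × H₃/K` and on `(H₂∖1) × H₃/K`, zero on the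
off-diagonal block `(u ∈ H₁, u' ∈ H₂ ∖ 1)`; so `card_add_card_le_finrank` applies to `J^K`.
Representation-theoretically: `J|_{H₃} ⊇ (|H₁| + |H₂| − 1) · ℂ[H₃]` as a right `H₃`-module (the
Neumann probes are permuted freely by `H₃`), i.e. `Φ_J|_{H₃} − (|H₁|+|H₂|−1)·reg` is a genuine character,
`Φ_J = Σ_{χ ∈ J} χ(1) χ`; taking `K`-invariants gives the displayed inequality.  It has force exactly
when `dim J^K < dim J / |K|`, i.e. for subgroups `K` acting nearly FREELY in the permutation modules
making up `J` — the regime invisible to the coset-certificate engine (`GLmLevelOneCertificates`,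
which needs large point stabilisers) and to the counts `N1, N2` (ORACLE-g19 §G19-6 (S-k)).

## Crux form

* `crux_freeModule_right` — for a witness of `SubgroupIdentityDesigns` at level `k` in `GL_m(𝔽_p)` and
  every `K ≤ H₃`: `(|H₁| + |H₂| − 1) · [H₃ : K] ≤ dim (F_k)^K` (right `K`-invariants of the level-`k`
  space).  The level-one evaluation of the right-hand side (orbit count) and its consequences are in
  the companion gen-20 files (`LevelOneInvariantDim`, `SemiregularLaw`; ORACLE-g20 §G20-2/3).

Sorry-free; standard axioms.
-/

set_option linter.dupNamespace false

noncomputable section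

open scoped BigOperators Classical Matrix
open Module (finrank)

namespace Summit.MatrixMultiplication.MatrixMultiplication.Theorems.SubgroupIdentityDesigns.Negative
namespace FreeModuleLaw

open Literature.Barriers.MatrixMultiplication (SubgroupTPP)

section Abstract

variable {G : Type} [Group G]

/-- The right-`K`-invariant part `J^K = {f ∈ J | f (g k) = f g, k ∈ K}` of a test space `J ≤ ℂ^G`. -/
def invRight (K : Subgroup G) (J : Submodule ℂ (G → ℂ)) : Submodule ℂ (G → ℂ) where
  carrier := {f | f ∈ J ∧ ∀ k ∈ K, ∀ g : G, f (g * k) = f g}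
  add_mem' := by
    rintro f f' ⟨hf, hfi⟩ ⟨hf', hfi'⟩
    exact ⟨J.add_mem hf hf', fun k hk g => by simp only [Pi.add_apply, hfi k hk g, hfi' k hk g]⟩
  zero_mem' := ⟨J.zero_mem, fun _ _ _ => rfl⟩
  smul_mem' := by
    rintro c f ⟨hf, hfi⟩
    exact ⟨J.smul_mem c hf, fun k hk g => by simp only [Pi.smul_apply, hfi k hk g]⟩

/-- Membership in `J^K`. -/
theorem mem_invRight {K : Subgroup G} {J : Submodule ℂ (G → ℂ)} {f : G → ℂ} :
    f ∈ invRight K J ↔ f ∈ J ∧ ∀ k ∈ K, ∀ g : G, f (g * k) = f g := Iff.rfl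

/-- `J^K ≤ J`. -/
theorem invRight_le (K : Subgroup G) (J : Submodule ℂ (G → ℂ)) : invRight K J ≤ J :=
  fun _ h => h.1

/-- `J ↦ J^K` is monotone. -/
theorem invRight_mono (K : Subgroup G) {J J' : Submodule ℂ (G → ℂ)} (h : J ≤ J') :
    invRight K J ≤ invRight K J' := fun _ hf => ⟨h hf.1, hf.2⟩

/-- `J^1 = J`. -/
theorem invRight_bot (J : Submodule ℂ (G → ℂ)) : invRight ⊥ J = J := by
  refine le_antisymm (invRight_le ⊥ J) fun f hf => ⟨hf, fun k hk g => ?_⟩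
  rw [Subgroup.mem_bot] at hk
  rw [hk, mul_one]

/-- The index bookkeeping: `|K| · [H₃ : K] = |H₃|` for `K ≤ H₃`. [Lagrange] -/
theorem card_mul_relIndex {K H : Subgroup G} (hK : K ≤ H) :
    Nat.card K * K.relIndex H = Nat.card H := by
  have h := (K.subgroupOf H).card_mul_index
  rwa [Nat.card_congr (Subgroup.subgroupOfEquivOfLe hK).toEquiv] at h

variable [Fintype G]

/-- The `K`-periodised probe `h ↦ Σ_{k ∈ K} f (u⁻¹ h k⁻¹ r⁻¹)` of a function `f` of a bi-invariant
space `J` lies in `J^K`. -/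
theorem probe_mem_invRight (J : Submodule ℂ (G → ℂ))
    (hJ : ∀ f ∈ J, ∀ s t : G, (fun g => f (s * g * t)) ∈ J) (K : Subgroup G) {f : G → ℂ}
    (hf : f ∈ J) (u r : G) :
    (fun h => ∑ k : K, f (u⁻¹ * h * ((k : G)⁻¹ * r⁻¹))) ∈ invRight K J := by
  refine ⟨?_, fun k₀ hk₀ h => ?_⟩
  · have hfun : (fun h => ∑ k : K, f (u⁻¹ * h * ((k : G)⁻¹ * r⁻¹))) =
        ∑ k : K, fun h => f (u⁻¹ * h * ((k : G)⁻¹ * r⁻¹)) := by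
      ext h; simp [Finset.sum_apply]
    rw [hfun]
    exact Submodule.sum_mem _ fun k _ => hJ f hf _ _
  · let e : K ≃ K := Equiv.mulRight (⟨k₀, hk₀⟩ : K)⁻¹
    refine Fintype.sum_equiv e _ _ fun k => ?_
    simp only [e, Equiv.coe_mulRight, Subgroup.coe_mul, Subgroup.coe_inv, mul_inv_rev, inv_inv,
      mul_assoc]

omit [Fintype G] in
/-- Read-out of the periodised probes (TPP): for `x ∈ H₁`, `y ∈ H₂`, coset representatives
`ρ q ∈ H₃` of `H₃ / K` and `k ∈ K ≤ H₃`,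
`f (x · y · (ρ q' k⁻¹ (ρ q)⁻¹)) = [x = 1 ∧ y = 1 ∧ q = q' ∧ k = 1]`. -/
theorem idTest_rep {H₁ H₂ H₃ : Subgroup G} (htpp : SubgroupTPP H₁ H₂ H₃)
    {f : G → ℂ} (h1 : f 1 = 1)
    (h0 : ∀ a ∈ H₁, ∀ b ∈ H₂, ∀ c ∈ H₃, a * b * c ≠ 1 → f (a * b * c) = 0)
    {K : Subgroup G} (hK : K ≤ H₃) (q q' : H₃ ⧸ K.subgroupOf H₃)
    {x y : G} (hx : x ∈ H₁) (hy : y ∈ H₂) (k : K) :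
    f (x * y * ((q'.out : H₃) * ((k : G)⁻¹ * ((q.out : H₃) : G)⁻¹))) =
      if x = 1 ∧ y = 1 ∧ q = q' ∧ k = 1 then 1 else 0 := by
  have hz : ((q'.out : H₃) : G) * ((k : G)⁻¹ * ((q.out : H₃) : G)⁻¹) ∈ H₃ :=
    H₃.mul_mem (q'.out).2 (H₃.mul_mem (H₃.inv_mem (hK k.2)) (H₃.inv_mem (q.out).2))
  rw [idTest_apply_eq_ite htpp h1 h0 hx hy hz]
  have key : ((q'.out : H₃) : G) * ((k : G)⁻¹ * ((q.out : H₃) : G)⁻¹) = 1 ↔ q = q' ∧ k = 1 := by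
    constructor
    · intro h
      -- `(q.out)⁻¹ * q'.out = k ∈ K`, so the cosets agree
      have hk : ((q.out : H₃) : G)⁻¹ * ((q'.out : H₃) : G) = k := by
        have := congrArg (fun t => ((q.out : H₃) : G)⁻¹ * t * ((q.out : H₃) : G) * (k : G)) h
        simpa [mul_assoc] using this
      have hmem : (q.out : H₃)⁻¹ * q'.out ∈ K.subgroupOf H₃ := by
        rw [Subgroup.mem_subgroupOf, Subgroup.coe_mul, Subgroup.coe_inv, hk]
        exact k.2
      have hqq : q = q' := by
        rw [← QuotientGroup.out_eq' q, ← QuotientGroup.out_eq' q']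
        exact QuotientGroup.eq.mpr hmem
      subst hqq
      refine ⟨rfl, ?_⟩
      ext
      simpa using hk.symm
    · rintro ⟨rfl, rfl⟩
      simp
  by_cases hc : x = 1 ∧ y = 1 ∧ q = q' ∧ k = 1
  · rw [if_pos hc, if_pos ⟨hc.1, hc.2.1, key.2 hc.2.2⟩]
  · rw [if_neg hc, if_neg]
    rintro ⟨hx1, hy1, hz1⟩
    exact hc ⟨hx1, hy1, key.1 hz1⟩

/-- **THE FREE-MODULE LAW (abstract, right form).**  For a bi-invariant test space `J ≤ ℂ^G`, a
subgroup-TPP triple `(H₁, H₂, H₃)` carrying an identity test `f ∈ J`, and every subgroup `K ≤ H₃`: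
`(|H₁| + |H₂| − 1) · [H₃ : K] ≤ dim J^K`. -/
theorem index_mul_le_finrank_invRight (J : Submodule ℂ (G → ℂ))
    (hJ : ∀ f ∈ J, ∀ s t : G, (fun g => f (s * g * t)) ∈ J)
    {H₁ H₂ H₃ : Subgroup G} (htpp : SubgroupTPP H₁ H₂ H₃)
    {f : G → ℂ} (hf : f ∈ J) (h1 : f 1 = 1)
    (h0 : ∀ a ∈ H₁, ∀ b ∈ H₂, ∀ c ∈ H₃, a * b * c ≠ 1 → f (a * b * c) = 0)
    {K : Subgroup G} (hK : K ≤ H₃) :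
    (Nat.card H₁ + (Nat.card H₂ - 1)) * K.relIndex H₃ ≤ finrank ℂ (invRight K J) := by
  classical
  -- coset representatives
  let Q := H₃ ⧸ K.subgroupOf H₃
  let ρ : Q → G := fun q => ((q.out : H₃) : G)
  -- the `|H₂| - 1` non-identity elements of `H₂`
  let S₂ := {b : H₂ // b ≠ 1}
  have hS₂ : Fintype.card S₂ = Nat.card H₂ - 1 := by
    simp only [S₂, Fintype.card_subtype_compl, Fintype.card_unique, Nat.card_eq_fintype_card]
  have h := LevelTwoBeatsCubes.Negative.card_add_card_le_finrank (A := H₁ × Q) (S := S₂ × Q)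
    (invRight K J) (fun a => (a.1 : G) * ρ a.2) (fun s => ((s.1 : H₂) : G) * ρ s.2) ?_ ?_
  · rw [Fintype.card_prod, Fintype.card_prod, hS₂, ← Nat.card_eq_fintype_card (α := H₁),
      ← add_mul] at h
    have hQ : Fintype.card Q = K.relIndex H₃ := by
      rw [← Nat.card_eq_fintype_card]; rfl
    rwa [hQ] at h
  · -- probes for the points `a · ρ q`
    rintro ⟨a, q⟩
    refine ⟨_, probe_mem_invRight J hJ K hf (a : G) (ρ q), ?_, ?_, ?_⟩
    · -- value `1` at its own point: only the term `k = 1` survives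
      show (∑ k : K, f ((a : G)⁻¹ * ((a : G) * ρ q) * ((k : G)⁻¹ * (ρ q)⁻¹))) = 1
      have hterm : ∀ k : K, f ((a : G)⁻¹ * ((a : G) * ρ q) * ((k : G)⁻¹ * (ρ q)⁻¹)) =
          if (1 : G) = 1 ∧ (1 : G) = 1 ∧ q = q ∧ k = 1 then 1 else 0 := fun k => by
        rw [← idTest_rep htpp h1 h0 hK q q H₁.one_mem H₂.one_mem k]
        congr 1; simp [ρ]
      simp_rw [hterm]
      simp [Finset.sum_ite_eq']
    · rintro ⟨a', q'⟩ hne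
      show (∑ k : K, f ((a : G)⁻¹ * ((a' : G) * ρ q') * ((k : G)⁻¹ * (ρ q)⁻¹))) = 0
      refine Finset.sum_eq_zero fun k _ => ?_
      have hx : (a : G)⁻¹ * (a' : G) ∈ H₁ := H₁.mul_mem (H₁.inv_mem a.2) a'.2
      have e : (a : G)⁻¹ * ((a' : G) * ρ q') * ((k : G)⁻¹ * (ρ q)⁻¹) =
          (a : G)⁻¹ * (a' : G) * 1 * (ρ q' * ((k : G)⁻¹ * (ρ q)⁻¹)) := by simp [ρ, mul_assoc]
      rw [e, idTest_rep htpp h1 h0 hK q q' hx H₂.one_mem k, if_neg]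
      rintro ⟨haa, -, hqq, -⟩
      apply hne
      have : a = a' := Subtype.ext (inv_mul_eq_one.1 haa)
      rw [this, hqq]
    · rintro ⟨b, q'⟩
      show (∑ k : K, f ((a : G)⁻¹ * (((b : H₂) : G) * ρ q') * ((k : G)⁻¹ * (ρ q)⁻¹))) = 0
      refine Finset.sum_eq_zero fun k _ => ?_
      have e : (a : G)⁻¹ * (((b : H₂) : G) * ρ q') * ((k : G)⁻¹ * (ρ q)⁻¹) =
          (a : G)⁻¹ * ((b : H₂) : G) * (ρ q' * ((k : G)⁻¹ * (ρ q)⁻¹)) := by simp [ρ, mul_assoc]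
      rw [e, idTest_rep htpp h1 h0 hK q q' (H₁.inv_mem a.2) (b : H₂).2 k, if_neg]
      rintro ⟨-, hb, -⟩
      exact b.2 (Subtype.ext hb)
  · -- probes for the points `b · ρ q`, `b ∈ H₂ ∖ 1`
    rintro ⟨b, q⟩
    refine ⟨_, probe_mem_invRight J hJ K hf ((b : H₂) : G) (ρ q), ?_, ?_⟩
    · show (∑ k : K, f (((b : H₂) : G)⁻¹ * (((b : H₂) : G) * ρ q) * ((k : G)⁻¹ * (ρ q)⁻¹))) = 1
      have hterm : ∀ k : K, f (((b : H₂) : G)⁻¹ * (((b : H₂) : G) * ρ q) * ((k : G)⁻¹ * (ρ q)⁻¹)) =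
          if (1 : G) = 1 ∧ (1 : G) = 1 ∧ q = q ∧ k = 1 then 1 else 0 := fun k => by
        rw [← idTest_rep htpp h1 h0 hK q q H₁.one_mem H₂.one_mem k]
        congr 1; simp [ρ]
      simp_rw [hterm]
      simp [Finset.sum_ite_eq']
    · rintro ⟨b', q'⟩ hne
      show (∑ k : K, f (((b : H₂) : G)⁻¹ * (((b' : H₂) : G) * ρ q') * ((k : G)⁻¹ * (ρ q)⁻¹))) = 0
      refine Finset.sum_eq_zero fun k _ => ?_
      have hy : ((b : H₂) : G)⁻¹ * ((b' : H₂) : G) ∈ H₂ :=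
        H₂.mul_mem (H₂.inv_mem (b : H₂).2) (b' : H₂).2
      have e : ((b : H₂) : G)⁻¹ * (((b' : H₂) : G) * ρ q') * ((k : G)⁻¹ * (ρ q)⁻¹) =
          1 * (((b : H₂) : G)⁻¹ * ((b' : H₂) : G)) * (ρ q' * ((k : G)⁻¹ * (ρ q)⁻¹)) := by
        simp [ρ, mul_assoc]
      rw [e, idTest_rep htpp h1 h0 hK q q' H₁.one_mem hy k, if_neg]
      rintro ⟨-, hbb, hqq, -⟩
      apply hne
      have : b = b' := Subtype.ext (Subtype.ext (inv_mul_eq_one.1 hbb))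
      rw [this, hqq]

/-- **Free-module law, multiplied out:** `|K| · dim J^K ≥ (|H₁| + |H₂| − 1) · |H₃|`. -/
theorem card_mul_le_card_mul_finrank_invRight (J : Submodule ℂ (G → ℂ))
    (hJ : ∀ f ∈ J, ∀ s t : G, (fun g => f (s * g * t)) ∈ J)
    {H₁ H₂ H₃ : Subgroup G} (htpp : SubgroupTPP H₁ H₂ H₃)
    {f : G → ℂ} (hf : f ∈ J) (h1 : f 1 = 1)
    (h0 : ∀ a ∈ H₁, ∀ b ∈ H₂, ∀ c ∈ H₃, a * b * c ≠ 1 → f (a * b * c) = 0)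
    {K : Subgroup G} (hK : K ≤ H₃) :
    (Nat.card H₁ + (Nat.card H₂ - 1)) * Nat.card H₃ ≤
      Nat.card K * finrank ℂ (invRight K J) := by
  calc (Nat.card H₁ + (Nat.card H₂ - 1)) * Nat.card H₃
      = Nat.card K * ((Nat.card H₁ + (Nat.card H₂ - 1)) * K.relIndex H₃) := by
        rw [← card_mul_relIndex hK]; ring
    _ ≤ Nat.card K * finrank ℂ (invRight K J) :=
        Nat.mul_le_mul_left _ (index_mul_le_finrank_invRight J hJ htpp hf h1 h0 hK)

end Abstract

/-! ## Crux form -/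

section Crux

open Summit.MatrixMultiplication.MatrixMultiplication.Theorems.LieRankDesigns.Negative (GLm Mat)
open Summit.MatrixMultiplication.MatrixMultiplication.Theorems.LevelOneGL2Designs.Negative
  (levelSubmodule levelSubmodule_bi_inv)
open PackingBridge (exists_test)

variable {p m k : ℕ} [hp : Fact p.Prime]

/-- **FREE-MODULE LAW FOR THE CRUX (right form).**  For every witness of `SubgroupIdentityDesigns`
(subgroup TPP + the level-`k` identity-design clause verbatim) and every subgroup `K ≤ H₃`:
`(|H₁| + |H₂| − 1) · [H₃ : K] ≤ dim (F_k)^K`, the right `K`-invariants of the level-`k` space. -/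
theorem crux_freeModule_right {H₁ H₂ H₃ : Subgroup (GLm p m)} (htpp : SubgroupTPP H₁ H₂ H₃)
    (hdes : ∃ c : Mat p m → ℂ, (∀ M, k < M.rank → c M = 0) ∧
      (∑ M, c M * ZMod.stdAddChar (Matrix.trace (M * ((1 : GLm p m) : Mat p m)))) = 1 ∧
      ∀ a ∈ H₁, ∀ b ∈ H₂, ∀ g ∈ H₃, a * b * g ≠ 1 →
        (∑ M, c M * ZMod.stdAddChar (Matrix.trace (M * ((a * b * g : GLm p m) : Mat p m)))) = 0)
    {K : Subgroup (GLm p m)} (hK : K ≤ H₃) :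
    (Nat.card H₁ + (Nat.card H₂ - 1)) * K.relIndex H₃ ≤
      finrank ℂ (invRight K (levelSubmodule p m k)) := by
  obtain ⟨f, hf, h1, h0⟩ := exists_test hdes
  exact index_mul_le_finrank_invRight (levelSubmodule p m k) levelSubmodule_bi_inv htpp hf h1 h0 hK

/-- Multiplied-out crux form: `(|H₁| + |H₂| − 1) · |H₃| ≤ |K| · dim (F_k)^K` for `K ≤ H₃`. -/
theorem crux_freeModule_right' {H₁ H₂ H₃ : Subgroup (GLm p m)} (htpp : SubgroupTPP H₁ H₂ H₃)
    (hdes : ∃ c : Mat p m → ℂ, (∀ M, k < M.rank → c M = 0) ∧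
      (∑ M, c M * ZMod.stdAddChar (Matrix.trace (M * ((1 : GLm p m) : Mat p m)))) = 1 ∧
      ∀ a ∈ H₁, ∀ b ∈ H₂, ∀ g ∈ H₃, a * b * g ≠ 1 →
        (∑ M, c M * ZMod.stdAddChar (Matrix.trace (M * ((a * b * g : GLm p m) : Mat p m)))) = 0)
    {K : Subgroup (GLm p m)} (hK : K ≤ H₃) :
    (Nat.card H₁ + (Nat.card H₂ - 1)) * Nat.card H₃ ≤
      Nat.card K * finrank ℂ (invRight K (levelSubmodule p m k)) := by
  obtain ⟨f, hf, h1, h0⟩ := exists_test hdes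
  exact card_mul_le_card_mul_finrank_invRight (levelSubmodule p m k) levelSubmodule_bi_inv htpp hf
    h1 h0 hK

end Crux

end FreeModuleLaw
end Summit.MatrixMultiplication.MatrixMultiplication.Theorems.SubgroupIdentityDesigns.Negative

end
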